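import Mathlib
import Summits.Ventures.PercRepro2.UnionRowMech

/-!
# The two-status union row from conditional positive association — the double-exclusion union
(blind cell PercRepro2, mine-1 g39; proofs/MINE1-UNIONROW2.md §4)

For `X = Y = {u, v}` the union row of row 2′CON-U restricts the covariance sum to all cells but
the two double-hit cells `(S, T)` and `(T, S)`. For up-set indicators `A, B` (times `Z²`):

  `Z·(Z·M(A∩B) − M(A)M(B)) − M(S,T)·Δ_A(S,T)Δ_B(S,T) − M(T,S)·Δ_A(T,S)Δ_B(T,S) ≥ 0`,
  `Δ_A(c) = Z·1_A(c) − M(A)`.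

THEOREM `double_exclusion_nonneg`: this follows from positive association of up-sets under `M`
and of up-sets and down-sets inside the six avoidance sets `{v ≠ T}`, `{u ≠ S}`, `{u ≠ T}`, `{v ≠ S}`,
`{u, v ≠ T}`, `{u, v ≠ S}` (the (Z)-PA given `t ↮ X` / `s ↮ X` for `X ∋ v`, `u`, or both) in EVERY
case except the two RESIDUAL ones — `(S,T) ∈ A ∩ B` with `(T,S) ∉ A ∪ B`, and its mirror — which
are excluded by hypothesis (MINE1-UNIONROW2.md §4 (ii)/(iii): nearly tight, open). The
single-exclusion lemma is re-proved here for a general cell `c` with its two avoidance sets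
(`single_exclusion_generic`), so that the `(T, S)` version is the same statement.
-/

namespace Summit.Ventures.PercRepro2

namespace UnionRowMech

open Finset

/-- The double-hit cell `(T, S)`. -/
def TS : Grid := (0, 2)

/-- The cells with `u ≠ T`: the avoidance event `t ↮ {s, u}`. -/
def Ru : Finset Grid := Finset.univ.filter (fun k => k.1 ≠ 0)

/-- The cells with `v ≠ S`: the avoidance event `s ↮ {t, v}`. -/
def Rv' : Finset Grid := Finset.univ.filter (fun k => k.2 ≠ 2)

/-- The cells with `u, v ≠ T`: the avoidance event `t ↮ {s, u, v}`. -/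
def R₀ : Finset Grid := Finset.univ.filter (fun k => k.1 ≠ 0 ∧ k.2 ≠ 0)

/-- The cells with `u, v ≠ S`: the avoidance event `s ↮ {t, u, v}`. -/
def R₀' : Finset Grid := Finset.univ.filter (fun k => k.1 ≠ 2 ∧ k.2 ≠ 2)

/-- Every cell with `u = T` lies below `(T, S)`. -/
lemma le_TS_of_fst_eq_zero : ∀ k : Grid, k.1 = 0 → k ≤ TS := by decide

/-- Every cell with `v = S` lies above `(T, S)`. -/
lemma TS_le_of_snd_eq_two : ∀ k : Grid, k.2 = 2 → TS ≤ k := by decide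

/-- An up-set not containing `(T, S)` lies inside `{u ≠ T}`. -/
lemma up_subset_Ru {A : Finset Grid} (hA : IsUp A) (h : TS ∉ A) : A ⊆ Ru := by
  intro k hk
  simp only [Ru, Finset.mem_filter, Finset.mem_univ, true_and]
  intro h1
  exact h (hA (le_TS_of_fst_eq_zero k h1) hk)

/-- A down-set not containing `(T, S)` lies inside `{v ≠ S}`. -/
lemma down_subset_Rv' {A : Finset Grid} (hA : IsDown A) (h : TS ∉ A) : A ⊆ Rv' := by
  intro k hk
  simp only [Rv', Finset.mem_filter, Finset.mem_univ, true_and]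
  intro h2
  exact h (hA (TS_le_of_snd_eq_two k h2) hk)

/-- An up-set containing neither double-hit cell lies inside `{u, v ≠ T}`. -/
lemma up_subset_R₀ {A : Finset Grid} (hA : IsUp A) (h1 : ST ∉ A) (h2 : TS ∉ A) : A ⊆ R₀ := by
  intro k hk
  simp only [R₀, Finset.mem_filter, Finset.mem_univ, true_and]
  exact ⟨fun h => h2 (hA (le_TS_of_fst_eq_zero k h) hk),
    fun h => h1 (hA (le_ST_of_snd_eq_zero k h) hk)⟩

/-- A down-set containing neither double-hit cell lies inside `{u, v ≠ S}`. -/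
lemma down_subset_R₀' {A : Finset Grid} (hA : IsDown A) (h1 : ST ∉ A) (h2 : TS ∉ A) :
    A ⊆ R₀' := by
  intro k hk
  simp only [R₀', Finset.mem_filter, Finset.mem_univ, true_and]
  exact ⟨fun h => h1 (hA (ST_le_of_fst_eq_two k h) hk),
    fun h => h2 (hA (TS_le_of_snd_eq_two k h) hk)⟩

variable {M : Grid → ℝ}

/-- A cell outside `Rc` bounds: `M(Rc) + M(c) ≤ Z`. -/
lemma mass_add_le_of_notMem (hM : ∀ k, 0 ≤ M k) {Rc : Finset Grid} {c : Grid} (hc : c ∉ Rc) :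
    mass M Rc + M c ≤ total M := by
  have h1 : mass M Rc + mass M (Finset.univ \ Rc) = total M := by
    unfold mass total
    rw [add_comm, Finset.sum_sdiff (Finset.subset_univ Rc)]
  have h2 : M c ≤ mass M (Finset.univ \ Rc) := by
    unfold mass
    refine Finset.single_le_sum (fun k _ => hM k) ?_
    simp [hc]
  linarith

/-- Two distinct cells outside `Rc` bound: `M(Rc) + M(c) + M(c′) ≤ Z`. -/
lemma mass_add_two_le_of_notMem (hM : ∀ k, 0 ≤ M k) {Rc : Finset Grid} {c c' : Grid}
    (hc : c ∉ Rc) (hc' : c' ∉ Rc) (hne : c ≠ c') : mass M Rc + (M c + M c') ≤ total M := by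
  have h1 : mass M Rc + mass M (Finset.univ \ Rc) = total M := by
    unfold mass total
    rw [add_comm, Finset.sum_sdiff (Finset.subset_univ Rc)]
  have h2 : M c + M c' ≤ mass M (Finset.univ \ Rc) := by
    unfold mass
    have : ({c, c'} : Finset Grid) ⊆ Finset.univ \ Rc := by
      intro k hk
      simp only [Finset.mem_insert, Finset.mem_singleton] at hk
      rcases hk with rfl | rfl <;> simp [hc, hc']
    calc M c + M c' = ∑ k ∈ ({c, c'} : Finset Grid), M k := by rw [Finset.sum_pair hne]
      _ ≤ ∑ k ∈ Finset.univ \ Rc, M k :=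
        Finset.sum_le_sum_of_subset_of_nonneg this fun k _ _ => hM k
  linarith

/-- **The single-exclusion row for a general cell `c`** with its avoidance sets `Rc` (containing
every up-set that misses `c`) and `Rc′` (containing every down-set that misses `c`). -/
theorem single_exclusion_generic (hM : ∀ k, 0 ≤ M k) {c : Grid} {Rc Rc' : Finset Grid}
    (hup : ∀ A : Finset Grid, IsUp A → c ∉ A → A ⊆ Rc)
    (hdown : ∀ A : Finset Grid, IsDown A → c ∉ A → A ⊆ Rc')
    (hcR : c ∉ Rc) (hcR' : c ∉ Rc')
    (hQ : ∀ A B : Finset Grid, IsUp A → IsUp B →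
      mass M A * mass M B ≤ mass M (A ∩ B) * total M)
    (hR : ∀ A B : Finset Grid, IsUp A → IsUp B → A ⊆ Rc → B ⊆ Rc →
      mass M A * mass M B ≤ mass M (A ∩ B) * mass M Rc)
    (hR' : ∀ A B : Finset Grid, IsDown A → IsDown B → A ⊆ Rc' → B ⊆ Rc' →
      mass M A * mass M B ≤ mass M (A ∩ B) * mass M Rc')
    {A B : Finset Grid} (hA : IsUp A) (hB : IsUp B) :
    0 ≤ total M * (total M * mass M (A ∩ B) - mass M A * mass M B) -
      M c * (total M * (if c ∈ A then 1 else 0) - mass M A) *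
        (total M * (if c ∈ B then 1 else 0) - mass M B) := by
  have hZ := total_nonneg hM
  have hc0 := hM c
  have hmA := mass_nonneg hM A
  have hmB := mass_nonneg hM B
  have hAZ := mass_le_total hM A
  have hBZ := mass_le_total hM B
  have hcov := hQ A B hA hB
  by_cases hA2 : c ∈ A <;> by_cases hB2 : c ∈ B
  · simp only [hA2, hB2, if_true, mul_one]
    have hA' := isDown_compl hA
    have hB' := isDown_compl hB
    have key := hR' _ _ hA' hB' (hdown _ hA' (by simp [hA2])) (hdown _ hB' (by simp [hB2]))
    rw [mass_compl, mass_compl, mass_compl_inter] at key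
    have hc := mass_nonneg hM ((Finset.univ \ A) ∩ (Finset.univ \ B))
    rw [mass_compl_inter] at hc
    have est := core_estimate key (mass_add_le_of_notMem hM hcR') hc hc0 hZ
    nlinarith [est]
  · simp only [hA2, hB2, if_true, if_false, mul_one, mul_zero, zero_sub]
    have : 0 ≤ M c * (total M - mass M A) * mass M B :=
      mul_nonneg (mul_nonneg hc0 (by linarith)) hmB
    nlinarith
  · simp only [hA2, hB2, if_true, if_false, mul_one, mul_zero, zero_sub]
    have : 0 ≤ M c * mass M A * (total M - mass M B) :=
      mul_nonneg (mul_nonneg hc0 hmA) (by linarith)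
    nlinarith
  · simp only [hA2, hB2, if_false, mul_zero, zero_sub]
    have key := hR A B hA hB (hup A hA hA2) (hup B hB hB2)
    have hc := mass_nonneg hM (A ∩ B)
    have est := core_estimate key (mass_add_le_of_notMem hM hcR) hc hc0 hZ
    nlinarith [est]

/-- `(S, T) ∉ R`, `(S, T) ∉ R′`, `(T, S) ∉ Ru`, `(T, S) ∉ Rv′`, and the two cells are distinct. -/
lemma ST_notMem_R : ST ∉ R := by decide
/-- `(S, T) ∉ R′`. -/
lemma ST_notMem_R' : ST ∉ R' := by decide
/-- `(T, S) ∉ Ru`. -/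
lemma TS_notMem_Ru : TS ∉ Ru := by decide
/-- `(T, S) ∉ Rv′`. -/
lemma TS_notMem_Rv' : TS ∉ Rv' := by decide
/-- `(S, T) ∉ R₀`. -/
lemma ST_notMem_R₀ : ST ∉ R₀ := by decide
/-- `(T, S) ∉ R₀`. -/
lemma TS_notMem_R₀ : TS ∉ R₀ := by decide
/-- `(S, T) ∉ R₀′`. -/
lemma ST_notMem_R₀' : ST ∉ R₀' := by decide
/-- `(T, S) ∉ R₀′`. -/
lemma TS_notMem_R₀' : TS ∉ R₀' := by decide
/-- The two double-hit cells are distinct. -/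
lemma ST_ne_TS : ST ≠ TS := by decide

/-- **The double-exclusion union row from conditional positive association**, in every case but
the two residual ones. -/
theorem double_exclusion_nonneg (hM : ∀ k, 0 ≤ M k)
    (hQ : ∀ A B : Finset Grid, IsUp A → IsUp B →
      mass M A * mass M B ≤ mass M (A ∩ B) * total M)
    (hR : ∀ A B : Finset Grid, IsUp A → IsUp B → A ⊆ R → B ⊆ R →
      mass M A * mass M B ≤ mass M (A ∩ B) * mass M R)
    (hR' : ∀ A B : Finset Grid, IsDown A → IsDown B → A ⊆ R' → B ⊆ R' →
      mass M A * mass M B ≤ mass M (A ∩ B) * mass M R')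
    (hRu : ∀ A B : Finset Grid, IsUp A → IsUp B → A ⊆ Ru → B ⊆ Ru →
      mass M A * mass M B ≤ mass M (A ∩ B) * mass M Ru)
    (hRv' : ∀ A B : Finset Grid, IsDown A → IsDown B → A ⊆ Rv' → B ⊆ Rv' →
      mass M A * mass M B ≤ mass M (A ∩ B) * mass M Rv')
    (hR₀ : ∀ A B : Finset Grid, IsUp A → IsUp B → A ⊆ R₀ → B ⊆ R₀ →
      mass M A * mass M B ≤ mass M (A ∩ B) * mass M R₀)
    (hR₀' : ∀ A B : Finset Grid, IsDown A → IsDown B → A ⊆ R₀' → B ⊆ R₀' →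
      mass M A * mass M B ≤ mass M (A ∩ B) * mass M R₀')
    {A B : Finset Grid} (hA : IsUp A) (hB : IsUp B)
    (hres : ¬ ((ST ∈ A ∧ ST ∈ B ∧ TS ∉ A ∧ TS ∉ B) ∨ (TS ∈ A ∧ TS ∈ B ∧ ST ∉ A ∧ ST ∉ B))) :
    0 ≤ total M * (total M * mass M (A ∩ B) - mass M A * mass M B) -
      M ST * (total M * (if ST ∈ A then 1 else 0) - mass M A) *
        (total M * (if ST ∈ B then 1 else 0) - mass M B) -
      M TS * (total M * (if TS ∈ A then 1 else 0) - mass M A) *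
        (total M * (if TS ∈ B then 1 else 0) - mass M B) := by
  have hZ := total_nonneg hM
  have hST0 := hM ST
  have hTS0 := hM TS
  have hmA := mass_nonneg hM A
  have hmB := mass_nonneg hM B
  have hAZ := mass_le_total hM A
  have hBZ := mass_le_total hM B
  have hcov := hQ A B hA hB
  -- the two single-exclusion bounds
  have hS := single_exclusion_generic hM (fun A hA h => up_subset_R hA h)
    (fun A hA h => down_subset_R' hA h) ST_notMem_R ST_notMem_R' hQ hR hR' hA hB
  have hT := single_exclusion_generic hM (fun A hA h => up_subset_Ru hA h)
    (fun A hA h => down_subset_Rv' hA h) TS_notMem_Ru TS_notMem_Rv' hQ hRu hRv' hA hB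
  by_cases hA1 : ST ∈ A <;> by_cases hB1 : ST ∈ B <;> by_cases hA2 : TS ∈ A <;>
    by_cases hB2 : TS ∈ B
  · -- both cells in `A ∩ B`: complements inside `{u, v ≠ S}`
    simp only [hA1, hB1, hA2, hB2, if_true, mul_one] at hS hT ⊢
    have hA' := isDown_compl hA
    have hB' := isDown_compl hB
    have key := hR₀' _ _ hA' hB' (down_subset_R₀' hA' (by simp [hA1]) (by simp [hA2]))
      (down_subset_R₀' hB' (by simp [hB1]) (by simp [hB2]))
    rw [mass_compl, mass_compl, mass_compl_inter] at key
    have hc := mass_nonneg hM ((Finset.univ \ A) ∩ (Finset.univ \ B))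
    rw [mass_compl_inter] at hc
    have est := core_estimate key
      (mass_add_two_le_of_notMem hM ST_notMem_R₀' TS_notMem_R₀' ST_ne_TS) hc
      (add_nonneg hST0 hTS0) hZ
    nlinarith [est]
  · -- `(S,T) ∈ A ∩ B`, `(T,S) ∈ A ∖ B`: the `(T,S)` term is `≤ 0`
    simp only [hA1, hB1, hA2, hB2, if_true, if_false, mul_one, mul_zero, zero_sub] at hS hT ⊢
    have : 0 ≤ M TS * (total M - mass M A) * mass M B :=
      mul_nonneg (mul_nonneg hTS0 (by linarith)) hmB
    nlinarith
  · simp only [hA1, hB1, hA2, hB2, if_true, if_false, mul_one, mul_zero, zero_sub] at hS hT ⊢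
    have : 0 ≤ M TS * mass M A * (total M - mass M B) :=
      mul_nonneg (mul_nonneg hTS0 hmA) (by linarith)
    nlinarith
  · -- residual (ii)
    exact absurd (Or.inl ⟨hA1, hB1, hA2, hB2⟩) hres
  · -- `(S,T) ∈ A ∖ B`: the `(S,T)` term is `≤ 0`; the `(T,S)` term by `hT`
    simp only [hA1, hB1, hA2, hB2, if_true, if_false, mul_one, mul_zero, zero_sub] at hS hT ⊢
    have : 0 ≤ M ST * (total M - mass M A) * mass M B :=
      mul_nonneg (mul_nonneg hST0 (by linarith)) hmB
    nlinarith
  · simp only [hA1, hB1, hA2, hB2, if_true, if_false, mul_one, mul_zero, zero_sub] at hS hT ⊢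
    have : 0 ≤ M ST * (total M - mass M A) * mass M B :=
      mul_nonneg (mul_nonneg hST0 (by linarith)) hmB
    nlinarith
  · simp only [hA1, hB1, hA2, hB2, if_true, if_false, mul_one, mul_zero, zero_sub] at hS hT ⊢
    have : 0 ≤ M ST * (total M - mass M A) * mass M B :=
      mul_nonneg (mul_nonneg hST0 (by linarith)) hmB
    nlinarith
  · simp only [hA1, hB1, hA2, hB2, if_true, if_false, mul_one, mul_zero, zero_sub] at hS hT ⊢
    have : 0 ≤ M ST * (total M - mass M A) * mass M B :=
      mul_nonneg (mul_nonneg hST0 (by linarith)) hmB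
    nlinarith
  · -- `(S,T) ∈ B ∖ A`
    simp only [hA1, hB1, hA2, hB2, if_true, if_false, mul_one, mul_zero, zero_sub] at hS hT ⊢
    have : 0 ≤ M ST * mass M A * (total M - mass M B) :=
      mul_nonneg (mul_nonneg hST0 hmA) (by linarith)
    nlinarith
  · simp only [hA1, hB1, hA2, hB2, if_true, if_false, mul_one, mul_zero, zero_sub] at hS hT ⊢
    have : 0 ≤ M ST * mass M A * (total M - mass M B) :=
      mul_nonneg (mul_nonneg hST0 hmA) (by linarith)
    nlinarith
  · simp only [hA1, hB1, hA2, hB2, if_true, if_false, mul_one, mul_zero, zero_sub] at hS hT ⊢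
    have : 0 ≤ M ST * mass M A * (total M - mass M B) :=
      mul_nonneg (mul_nonneg hST0 hmA) (by linarith)
    nlinarith
  · simp only [hA1, hB1, hA2, hB2, if_true, if_false, mul_one, mul_zero, zero_sub] at hS hT ⊢
    have : 0 ≤ M ST * mass M A * (total M - mass M B) :=
      mul_nonneg (mul_nonneg hST0 hmA) (by linarith)
    nlinarith
  · -- residual (iii)
    exact absurd (Or.inr ⟨hA2, hB2, hA1, hB1⟩) hres
  · -- `(S,T) ∉ A ∪ B`, `(T,S) ∈ A ∖ B`: the `(T,S)` term is `≤ 0`, the `(S,T)` term by `hS`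
    simp only [hA1, hB1, hA2, hB2, if_true, if_false, mul_one, mul_zero, zero_sub] at hS hT ⊢
    have : 0 ≤ M TS * (total M - mass M A) * mass M B :=
      mul_nonneg (mul_nonneg hTS0 (by linarith)) hmB
    nlinarith
  · simp only [hA1, hB1, hA2, hB2, if_true, if_false, mul_one, mul_zero, zero_sub] at hS hT ⊢
    have : 0 ≤ M TS * mass M A * (total M - mass M B) :=
      mul_nonneg (mul_nonneg hTS0 hmA) (by linarith)
    nlinarith
  · -- neither cell in `A ∪ B`: both inside `{u, v ≠ T}`
    simp only [hA1, hB1, hA2, hB2, if_false, mul_zero, zero_sub] at hS hT ⊢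
    have key := hR₀ A B hA hB (up_subset_R₀ hA hA1 hA2) (up_subset_R₀ hB hB1 hB2)
    have hc := mass_nonneg hM (A ∩ B)
    have est := core_estimate key
      (mass_add_two_le_of_notMem hM ST_notMem_R₀ TS_notMem_R₀ ST_ne_TS) hc
      (add_nonneg hST0 hTS0) hZ
    nlinarith [est]

end UnionRowMech

end Summit.Ventures.PercRepro2
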